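import Literature.NumberTheory.LFunctions.FordVinogradovBridge
import HarnessLib

/-!
# Toolkit for Vinogradov's integral: diagonal solutions and Hölder interpolation

Topic `Literature/NumberTheory/LFunctions`.  Everything in this file is PROVED; no definition and
no named fact is introduced.

Two elementary facts about `J_{s,k}(I)` (`VMV.J k s I`, the number of solutions of Vinogradov's
system with `x_i, y_i ∈ I`) used throughout K. Ford, *Vinogradov's integral and bounds for the
Riemann zeta function*, Proc. LMS 85 (2002), §§3–6:

* `FordVK.card_pow_le_J` — the diagonal solutions: `|I|^s ≤ J_{s,k}(I)` (Ford (1.5), second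
  alternative; used in the "trivial solutions" contradictions of Lemmas 3.2, 4.1, 6.6);
* `FordVK.J_interpolate` — log-convexity in `s` ("by Hölder's inequality"):
  `J_{s,k}(I) ≤ J_{a,k}(I)^{(b-s)/(b-a)} J_{b,k}(I)^{(s-a)/(b-a)}` for `a ≤ s ≤ b`, `a < b`
  (Ford, proof of Theorem 3 (`s = nk + u`), (4.19), and Lemma 4.1 (last display)), from the mean
  value `J_{s,k}(I) = ∫_{[0,1]^k} |f(α)|^{2s} dα` (`FordVK.integral_norm_tp_nu_pow`) and Hölder's
  inequality on the torus.

## References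

* K. Ford, *Vinogradov's integral and bounds for the Riemann zeta function*, Proc. London Math.
  Soc. (3) 85 (2002), 565–633; arXiv:1910.08209. (1.5); proofs of Theorem 3, Lemma 4.1, (4.19).
  [Ford2002]
-/

noncomputable section

open Finset MeasureTheory Real

namespace Literature.NumberTheory.LFunctions
namespace FordVK

open VMV

/-- **Diagonal solutions**: `|I|^s ≤ J_{s,k}(I)`. [cite: Ford2002, (1.5)] -/
theorem card_pow_le_J (n s : ℕ) (I : Finset ℤ) : I.card ^ s ≤ J n s I := by
  classical
  unfold J Jc
  rw [← card_tuples s I]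
  calc (tuples s I).card = ((tuples s I).image fun x => (x, x)).card := by
        rw [Finset.card_image_of_injective _ fun x y h => (Prod.ext_iff.1 h).1]
    _ ≤ _ := by
        refine Finset.card_le_card fun xy hxy => ?_
        rw [Finset.mem_image] at hxy
        obtain ⟨x, hx, rfl⟩ := hxy
        rw [Finset.mem_filter, Finset.mem_product]
        exact ⟨⟨hx, hx⟩, by simp⟩

/-- **Hölder interpolation in the number of variables**: for `a ≤ s ≤ b`, `a < b`,
`J_{s,k}(I) ≤ J_{a,k}(I)^{(b-s)/(b-a)} · J_{b,k}(I)^{(s-a)/(b-a)}`.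
[cite: Ford2002, proof of Theorem 3 ("By Hölder's inequality") and (4.19)] -/
theorem J_interpolate (n : ℕ) (I : Finset ℤ) {a s b : ℕ} (has : a ≤ s) (hsb : s ≤ b) (hab : a < b) :
    (J n s I : ℝ) ≤ (J n a I : ℝ) ^ (((b : ℝ) - s) / ((b : ℝ) - a))
      * (J n b I : ℝ) ^ (((s : ℝ) - a) / ((b : ℝ) - a)) := by
  have hba : (0 : ℝ) < (b : ℝ) - a := by
    have : (a : ℝ) < b := by exact_mod_cast hab
    linarith
  -- the endpoint cases
  rcases eq_or_lt_of_le has with rfl | has'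
  · rw [div_self hba.ne', Real.rpow_one, sub_self, zero_div, Real.rpow_zero, mul_one]
  rcases eq_or_lt_of_le hsb with rfl | hsb'
  · rw [sub_self, zero_div, Real.rpow_zero, one_mul, div_self hba.ne', Real.rpow_one]
  -- the exponents
  set θ : ℝ := ((b : ℝ) - s) / ((b : ℝ) - a) with hθ
  have hθ0 : 0 < θ := by
    rw [hθ]; refine div_pos ?_ hba
    have : (s : ℝ) < b := by exact_mod_cast hsb'
    linarith
  have hθ1 : θ < 1 := by
    rw [hθ, div_lt_one hba]
    have : (a : ℝ) < s := by exact_mod_cast has'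
    linarith
  have h1θ : 0 < 1 - θ := by linarith
  have hθ' : ((s : ℝ) - a) / ((b : ℝ) - a) = 1 - θ := by
    rw [hθ]; field_simp; ring
  rw [hθ']
  have hpq : (1 / θ).HolderConjugate (1 / (1 - θ)) := Real.holderConjugate_one_div hθ0 h1θ (by ring)
  -- the measure on the box
  haveI : Fact (volume (box n) < ⊤) := ⟨(isCompact_box n).measure_lt_top⟩
  set μ : Measure (Fin n → ℝ) := volume.restrict (box n) with hμ
  set g : (Fin n → ℝ) → ℝ := fun α => ‖tp I (nu n) α‖ with hg
  have hg0 : ∀ α, 0 ≤ g α := fun α => norm_nonneg _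
  have hgc : Continuous g := (continuous_tp _ _).norm
  have hgle : ∀ α, g α ≤ I.card := fun α => norm_tp_le _ _ _
  -- the two factors
  set f₁ : (Fin n → ℝ) → ℝ := fun α => g α ^ (2 * (a : ℝ) * θ) with hf₁
  set f₂ : (Fin n → ℝ) → ℝ := fun α => g α ^ (2 * (b : ℝ) * (1 - θ)) with hf₂
  have hf₁0 : ∀ α, 0 ≤ f₁ α := fun α => Real.rpow_nonneg (hg0 α) _
  have hf₂0 : ∀ α, 0 ≤ f₂ α := fun α => Real.rpow_nonneg (hg0 α) _
  have hmem : ∀ (e : ℝ) (he : 0 ≤ e) (p : ENNReal), MemLp (fun α => g α ^ e) p μ := by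
    intro e he p
    refine MemLp.of_bound ((hgc.rpow_const fun _ => Or.inr he).aestronglyMeasurable) ((I.card : ℝ) ^ e)
      (ae_of_all _ fun α => ?_)
    rw [Real.norm_eq_abs, abs_of_nonneg (Real.rpow_nonneg (hg0 α) _)]
    exact Real.rpow_le_rpow (hg0 α) (hgle α) he
  have hH := integral_mul_le_Lp_mul_Lq_of_nonneg hpq (ae_of_all _ hf₁0) (ae_of_all _ hf₂0)
    (hmem _ (by positivity) _) (hmem _ (by positivity) _) (μ := μ)
  -- identify the three integrals
  have hprod : ∀ α, f₁ α * f₂ α = g α ^ (2 * s) := by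
    intro α
    rw [hf₁, hf₂]
    simp only
    rw [← Real.rpow_add_of_nonneg (hg0 α) (by positivity) (by positivity),
      show 2 * (a : ℝ) * θ + 2 * (b : ℝ) * (1 - θ) = ((2 * s : ℕ) : ℝ) by
        rw [hθ]; push_cast; field_simp; ring,
      Real.rpow_natCast]
  have hpow₁ : ∀ α, f₁ α ^ (1 / θ) = g α ^ (2 * a) := by
    intro α
    rw [hf₁]; simp only
    rw [← Real.rpow_mul (hg0 α), show 2 * (a : ℝ) * θ * (1 / θ) = ((2 * a : ℕ) : ℝ) by
      push_cast; field_simp, Real.rpow_natCast]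
  have hpow₂ : ∀ α, f₂ α ^ (1 / (1 - θ)) = g α ^ (2 * b) := by
    intro α
    rw [hf₂]; simp only
    rw [← Real.rpow_mul (hg0 α), show 2 * (b : ℝ) * (1 - θ) * (1 / (1 - θ)) = ((2 * b : ℕ) : ℝ) by
      push_cast; field_simp, Real.rpow_natCast]
  simp_rw [hprod, hpow₁, hpow₂, one_div_one_div] at hH
  rw [hμ, hg] at hH
  simp only at hH
  rw [integral_norm_tp_nu_pow n s I, integral_norm_tp_nu_pow n a I, integral_norm_tp_nu_pow n b I] at hH
  exact hH

end FordVK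
end Literature.NumberTheory.LFunctions
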